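import Summits.HodgeConjecture.HodgeConjecture.Theorems.VHCAbelianSchemesRoadDiagonal
import Literature.AlgebraicGeometry.HodgeTheory.TwistedPerfectAdmissibilityInitialSegment
import HarnessLib

/-!
# Road b02 (`VHCAbelianSchemesRoad`, D-0059) — the `closes`-KERNEL for the PRIMED admissibility notions
# (`bfSingleAdmissible' ≤ Adm`, in particular `AdmTw' := gluableSigmaAdmissible ∨ bfSingleAdmissible'`)

research route conditional on HC_CM; not a corollary; Q11.4-sentence-2 already refuted in dim ≥ 3.

FACT-FREE bookkeeping (seat ring2-b06 gen 120; helper `--supports stmt-HodgeConjecture-19275`; the route file, its `closes`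
glue of record, the binder of record and the crux skeleton v3.1 are untouched). The tenure planner's binder-19275 restate to the
primed door `TwistedPerfectDoorVHC C AdmTw'` (door-slice audit repair 1, `LEAD/ASK#door-admissibility-prime`; ring2 LEAD 156
records item (4), director-hodge R9.1) needs the `closes` kernel `hc_av_of_exceptionalRegimeAt_twisted_diagonal_two` of
`VHCAbelianSchemesRoadDiagonal.lean` with its inclusion hypothesis `hAdm : bfSingleAdmissible ≤ Adm` REPLACED by
`hAdm' : bfSingleAdmissible' ≤ Adm`. The only use of `hAdm` there is regime 1 (the Lefschetz regime) via the NULL DATUM, which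
the tree types on the index set `I = {p}` (`HasNullDatum`) — NOT an initial segment for `p ≥ 2`, so not `bfSingleAdmissible'`.
This file re-runs regime 1 with the null datum on the INITIAL-SEGMENT index set `I = {0, …, p} = Finset.Iic p` (the zero sheaf
is `J`-semiregular for every `J`, all its classes vanish, `p ∈ Iic p`), and then the kernel verbatim:

* §1 `admissibleRepresentativesLef_pointwise_of_lefschetz_Iic`, `lefAtLefschetzRegime_of_nullDatum_Iic` — regime 1 for every
  door admitting the zero family on `Finset.Iic p` (the tree's `…_of_lefschetz` / `…_of_hasNullDatum` with `{p} ↦ Iic p`).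
* §2 `bfSheafClass_zero_Iic`, `twistedReflexiveClass_of_isISemiregular_prime`, `nullDatum_Iic_twistedReflexiveClass_prime`,
  `lefAtLefschetzRegime_twistedReflexiveClass_prime` — the twisted door has the `Iic` null datum and satisfies regime 1 for
  EVERY `Adm ⊇ bfSingleAdmissible'` (`Finset.isShiftedInitialSegment_Iic`).
* §3 `admissibleRepresentativesLefAtDeg_twisted_of_exceptionalRegimeAt_prime`, **`hc_av_of_exceptionalRegimeAt_twisted_diagonal_two_prime`**,
  `hc_av_of_hcUpToDim_five_of_exceptionalRegimeAt_twisted_diagonal_three_prime` — the `closes`-shape kernels with `hAdm'`,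
  and their instances at `AdmTw'` (`hAdm' := Or.inr`): `hc_av_of_exceptionalRegimeAt_admTw'_diagonal_two`.

READING (for the planner; no edit asked). These kernels consume the door AND the diagonal crux slice at the SAME notion `Adm`;
with `Adm := AdmTw'` that is «19275 restated AND 19787 read at `AdmTw'`» (LEAD 156's one edit). The director's preferred
shape R9.1 (a) — door at `AdmTw'`, representatives (19787) left at `AdmTw` — is NOT served by a kernel of this form and cannot
be by bookkeeping alone: a regime-2 datum at `AdmTw` in the Buchweitz–Flenner disjunct may carry a non-initial index set `I`;
enlarging `I` keeps `I`-semiregularity (joint injectivity is monotone in the tested set) but every added degree `q` requires a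
global flat class `V_q` of Hodge type `(q,q)` on all fibres restricting to `(exp B₀ ∪ ch E)_q` — mathematics, not glue.

Nothing here says any cell, carrier statement, residual, K-SR♭∃, VHC, `HC_AV` or HC holds; `HC_CM` occurs nowhere; no statement
of any item is touched. References: [cite: BuchweitzFlenner2003, §5 (I-semiregular) and Thm. 5.1]
[cite: Pridham2024Semiregularity, Rem. 2.26 with Cor. 2.25] [cite: vanGeemen1994HodgeAV, §2.4]
[cite: Bloch1972Semiregularity, Remark (7.5)] [cite: Andre1996Motifs, §6.3 Lemmes 6.3.1–6.3.3]
[cite: BrosnanFangNiePearlstein2009, §6 Lemma 48] [cite: Fulton1998, Example 3.2.3].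
-/

noncomputable section

open CategoryTheory CategoryTheory.Limits AlgebraicGeometry Topology ZeroObject

namespace Summit.HodgeConjecture.HodgeConjecture.Ring2.SemiregularRepresentatives

-- the cell's namespace repeats the summit name (`Summit.HodgeConjecture.HodgeConjecture…`), as in every `Ring2*` file
set_option linter.dupNamespace false

open Literature.AlgebraicGeometry Literature.AlgebraicGeometry.Motives Literature.AlgebraicGeometry.Modules
open Literature.AlgebraicGeometry.HodgeTheory
open Literature.AlgebraicGeometry.KTheory
open Literature.AlgebraicTopology.SingularHomology
open Literature.AlgebraicGeometry.Andre1996 (andre1996_cmAnchoredPencil andre1996_cmHodgeClasses_algebraicallyAnchoredPencils)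
open Literature.Barriers.HodgeConjecture (divisorClassesSpan)
open Summit.Ventures.HSemireg (ObjClass bfSheafClass LocalVariationalHodgeFor)
open Summit.HodgeConjecture.HodgeConjecture.Ring2.Binders
open Summit.HodgeConjecture.HodgeConjecture.Ring2.ClassTargets

/-! ## §1 Regime 1 from the null datum on the initial-segment index set `{0, …, p}` -/

/-- **Where `W` is fibrewise Lefschetz the crux is free — null datum on `I = {0, …, p}`**: if the door admits the zero family
`κ = 0` on `Finset.Iic p`, the data `I = Iic p`, `κ = 0`, `V = 0`, `a = 1`, `Z = −W` witness K-SR♭ at `s₀` (the tree's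
`admissibleRepresentativesLef_pointwise_of_lefschetz` with `{p}` replaced by the initial segment `{0, …, p}`).
[cite: vanGeemen1994HodgeAV, §2.4] [cite: Bloch1972Semiregularity, Remark (7.5)] -/
theorem admissibleRepresentativesLef_pointwise_of_lefschetz_Iic {𝒪 : ObjClass}
    (h𝒪 : ∀ (n : ℕ) (X₀ : SchemeOver ℂ) (p : ℕ), 𝒪 n X₀ (Finset.Iic p) (fun _ => 0))
    {n p : ℕ} {𝒳 S : SchemeOver ℂ} (f : 𝒳 ⟶ S) (W : complexBetti 𝒳 (2 * p))
    (hW : ∀ s : ComplexPoints S, IsRationalClass (complexBetti.map (fiberι f s) (2 * p) W) ∧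
        IsOfHodgeType n (fiberOver f s) (2 * p) p p (complexBetti.map (fiberι f s) (2 * p) W))
    (hWL : ∀ s : ComplexPoints S,
      complexBetti.map (fiberι f s) (2 * p) W ∈ algebraicClasses (fiberOver f s) p ∧
      complexBetti.map (fiberι f s) (2 * p) W ∈ divisorClassesSpan (fiberOver f s) n p)
    (s₀ : ComplexPoints S) :
    ∃ (I : Finset ℕ) (κ : (q : ℕ) → complexBetti (fiberOver f s₀) (2 * q))
      (V : (q : ℕ) → complexBetti 𝒳 (2 * q)) (a : ℂ) (Z : complexBetti 𝒳 (2 * p)),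
      p ∈ I ∧ 𝒪 n (fiberOver f s₀) I κ ∧ a ≠ 0 ∧
      (∀ s : ComplexPoints S,
        complexBetti.map (fiberι f s) (2 * p) Z ∈ algebraicClasses (fiberOver f s) p ∧
        complexBetti.map (fiberι f s) (2 * p) Z ∈ divisorClassesSpan (fiberOver f s) n p) ∧
      V p = a • W + Z ∧
      (∀ q ∈ I, κ q = complexBetti.map (fiberι f s₀) (2 * q) (V q)) ∧
      (∀ q ∈ I, ∀ s : ComplexPoints S,
        IsOfHodgeType n (fiberOver f s) (2 * q) q q (complexBetti.map (fiberι f s) (2 * q) (V q))) := by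
  refine ⟨Finset.Iic p, fun _ => 0, fun _ => 0, 1, -W, Finset.mem_Iic.2 le_rfl, h𝒪 n _ p, one_ne_zero,
    fun s => ⟨?_, ?_⟩, ?_, fun q _ => ?_, fun q _ s => ?_⟩
  · rw [map_neg]; exact Submodule.neg_mem _ (hWL s).1
  · rw [map_neg]; exact Submodule.neg_mem _ (hWL s).2
  · rw [one_smul, add_neg_cancel]
  · rw [map_zero]
  · obtain ⟨A, -⟩ := (hW s).2
    rw [map_zero]
    exact IsOfHodgeType.zero A _ _ _

/-- **A door admitting the zero family on `{0, …, p}` satisfies regime 1 (the Lefschetz regime) of K-SR♭∃**, anchor `s₁ := s₀`.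
[cite: vanGeemen1994HodgeAV, §2.4] [cite: Bloch1972Semiregularity, Remark (7.5)] -/
theorem lefAtLefschetzRegime_of_nullDatum_Iic {𝒪 : ObjClass}
    (h𝒪 : ∀ (n : ℕ) (X₀ : SchemeOver ℂ) (p : ℕ), 𝒪 n X₀ (Finset.Iic p) (fun _ => 0)) : LefAtLefschetzRegime 𝒪 := by
  intro n 𝒳 S f hf h𝒳 hirr haff hsm hdim habel he p W hW s₀ hs₀ hL
  obtain ⟨I, κ, V, a, Z, h⟩ := admissibleRepresentativesLef_pointwise_of_lefschetz_Iic h𝒪 f W hW hL s₀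
  exact ⟨s₀, I, κ, V, a, Z, h⟩

/-! ## §2 The twisted door has the `{0, …, p}` null datum for every `Adm ⊇ bfSingleAdmissible'` -/

/-- **The Buchweitz–Flenner sheaf class admits the zero family on every index set** (here `Finset.Iic p`): the zero sheaf is
finite locally free, `J`-semiregular for every `J`, and `ch_q(0) = 0`. [cite: Fulton1998, Example 3.2.3]
[cite: BuchweitzFlenner2003, §5 (I-semiregular)] -/
theorem bfSheafClass_zero_Iic (C : ChernCharacterBetti) (n : ℕ) (X₀ : SchemeOver ℂ) (p : ℕ) :
    bfSheafClass C n X₀ (Finset.Iic p) (fun _ => 0) := by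
  refine ⟨0, (hasRankLE_zero_of_isZero (isZero_zero _)).isFiniteLocallyFree,
    isISemiregular_of_isZero (isZero_zero _) _ _, fun q _ => ?_⟩
  exact (C.ch_eq_zero_of_isZero (isZero_zero _) q).symm

variable {C : ChernCharacterBetti} {Adm : PerfectAdmissibility} {n : ℕ} {X₀ : SchemeOver ℂ} {I : Finset ℕ}
  {κ : (p : ℕ) → complexBetti X₀ (2 * p)}

/-- **An `I`-semiregular vector bundle on an INITIAL-SEGMENT index set is a member of the twisted door for every
`Adm ⊇ bfSingleAdmissible'`** (`B₀ = 0`; the tree's `twistedReflexiveClass_of_isISemiregular` at `bfSingleAdmissible`, then the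
index conjunct). [cite: BuchweitzFlenner2003, §5 (I-semiregular) and Thm. 5.1 (hypotheses)]
[cite: Pridham2024Semiregularity, Rem. 2.26 with Cor. 2.25] -/
theorem twistedReflexiveClass_of_isISemiregular_prime
    (hAdm' : ∀ n X₀ I E, bfSingleAdmissible' n X₀ I E → Adm n X₀ I E) (E₀ : X₀.left.Modules)
    (hE₀ : IsFiniteLocallyFree E₀) (hsr : IsISemiregular hE₀ {q | q + 1 ∈ I}) (hI : I.IsShiftedInitialSegment)
    (hκ : ∀ p ∈ I, κ p = C.ch X₀ E₀ p) : twistedReflexiveClass C Adm n X₀ I κ := by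
  obtain ⟨E, hE, B₀, hA, hBr, hBa, hκ'⟩ :=
    twistedReflexiveClass_of_isISemiregular (C := C) (Adm := bfSingleAdmissible) (fun _ _ _ _ h => h) E₀ hE₀ hsr hκ
  exact ⟨E, hE, B₀, hAdm' _ _ _ _ ⟨hA, hI⟩, hBr, hBa, hκ'⟩

/-- **The sheaf door on an initial-segment index set is inside the twisted door** for every `Adm ⊇ bfSingleAdmissible'`.
[cite: BuchweitzFlenner2003, §5 (I-semiregular) and Thm. 5.1 (hypotheses)] -/
theorem bfSheafClass_le_twistedReflexiveClass_prime
    (hAdm' : ∀ n X₀ I E, bfSingleAdmissible' n X₀ I E → Adm n X₀ I E) (hI : I.IsShiftedInitialSegment)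
    (h : bfSheafClass C n X₀ I κ) : twistedReflexiveClass C Adm n X₀ I κ := by
  obtain ⟨E₀, hE₀, hsr, hκ⟩ := h
  exact twistedReflexiveClass_of_isISemiregular_prime hAdm' E₀ hE₀ hsr hI hκ

variable (C Adm) in
/-- **The twisted door admits the zero family on `{0, …, p}`** for every `Adm ⊇ bfSingleAdmissible'` (the zero sheaf in degree
`0`, `B₀ = 0`, index set `Finset.Iic p` — an initial segment, `Finset.isShiftedInitialSegment_Iic`).
[cite: BuchweitzFlenner2003, §5 Thm. 5.1 (hypotheses)] [cite: Fulton1998, Example 3.2.3] -/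
theorem nullDatum_Iic_twistedReflexiveClass_prime
    (hAdm' : ∀ n X₀ I E, bfSingleAdmissible' n X₀ I E → Adm n X₀ I E) :
    ∀ (n : ℕ) (X₀ : SchemeOver ℂ) (p : ℕ), twistedReflexiveClass C Adm n X₀ (Finset.Iic p) (fun _ => 0) :=
  fun n X₀ p => bfSheafClass_le_twistedReflexiveClass_prime hAdm' (Finset.isShiftedInitialSegment_Iic p)
    (bfSheafClass_zero_Iic C n X₀ p)

variable (C Adm) in
/-- **The twisted door satisfies regime 1** for every `Adm ⊇ bfSingleAdmissible'` — the primed twin of the tree's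
`lefAtLefschetzRegime_twistedReflexiveClass`. [cite: vanGeemen1994HodgeAV, §2.4] [cite: BuchweitzFlenner2003, §5 Thm. 5.1] -/
theorem lefAtLefschetzRegime_twistedReflexiveClass_prime
    (hAdm' : ∀ n X₀ I E, bfSingleAdmissible' n X₀ I E → Adm n X₀ I E) :
    LefAtLefschetzRegime (twistedReflexiveClass C Adm) :=
  lefAtLefschetzRegime_of_nullDatum_Iic (nullDatum_Iic_twistedReflexiveClass_prime C Adm hAdm')

/-- **Regime 1 of the road's PRIMED twisted door `twistedReflexiveClass C AdmTw'`,
`AdmTw' := gluableSigmaAdmissible ∨ bfSingleAdmissible'`** (`hAdm' := Or.inr`). [cite: vanGeemen1994HodgeAV, §2.4]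
[cite: BuchweitzFlenner2003, §5 Thm. 5.1] -/
theorem lefAtLefschetzRegime_admTw' (C : ChernCharacterBetti) :
    LefAtLefschetzRegime (twistedReflexiveClass C
      (fun n X₀ I E => Summit.Ventures.HSemireg.gluableSigmaAdmissible n X₀ I E ∨ bfSingleAdmissible' n X₀ I E)) :=
  lefAtLefschetzRegime_twistedReflexiveClass_prime C _ (fun _ _ _ _ h => Or.inr h)

/-! ## §3 The `closes`-shape kernels with `bfSingleAdmissible' ≤ Adm` -/

variable (C) in
/-- **The graded crux over the twisted door from its regime 2 at `(n, p)`**, for every admissibility notion containing the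
PRIMED Buchweitz–Flenner notion (regime 1 by the `Iic` null datum). [cite: vanGeemen1994HodgeAV, §2.4]
[cite: BuchweitzFlenner2003, §5 Thm. 5.1] -/
theorem admissibleRepresentativesLefAtDeg_twisted_of_exceptionalRegimeAt_prime
    (hAdm' : ∀ n X₀ I E, bfSingleAdmissible' n X₀ I E → Adm n X₀ I E) {n p : ℕ}
    (h : LefAtExceptionalRegimeAt (twistedReflexiveClass C Adm) n p) :
    AdmissibleRepresentativesLefAtDeg (twistedReflexiveClass C Adm) n p :=
  admissibleRepresentativesLefAtDeg_of_regimes (lefAtLefschetzRegime_twistedReflexiveClass_prime C Adm hAdm') h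

/-- **`HC_AV` in the `closes`-shape of road b02 for an admissibility notion `Adm ⊇ bfSingleAdmissible'`** — the kernel
`hc_av_of_exceptionalRegimeAt_twisted_diagonal_two` with `hAdm` replaced by the PRIMED inclusion `hAdm'`: K-C, the diagonal
slice `∀ C m, 2 ≤ m → LefAtExceptionalRegimeAt (twisted door at Adm) (2m) m` of the crux, the door `TwistedPerfectDoorVHC C Adm`,
Raynaud, André #21/#22; no class target, no `HC_CM`. [cite: Andre1996Motifs, §6.3 Lemmes 6.3.1–6.3.3]
[cite: BrosnanFangNiePearlstein2009, §6 Lemma 48] [cite: Pridham2024Semiregularity, Rem. 2.26 with Cor. 2.25]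
[cite: GortzWedhorn2023, Thm. 27.291] -/
theorem hc_av_of_exceptionalRegimeAt_twisted_diagonal_two_prime (hC : ChernCharacterOnBetti)
    {Adm : PerfectAdmissibility} (hAdm' : ∀ n X₀ I E, bfSingleAdmissible' n X₀ I E → Adm n X₀ I E)
    (hDiag : ∀ (C : ChernCharacterBetti) (m : ℕ), 2 ≤ m → LefAtExceptionalRegimeAt (twistedReflexiveClass C Adm) (2 * m) m)
    (hDoor : ∀ C : ChernCharacterBetti, TwistedPerfectDoorVHC C Adm)
    (hR : raynaud1970_abelianScheme_section_projective) (h₂₁ : andre1996_cmAnchoredPencil)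
    (h₂₂ : andre1996_cmHodgeClasses_algebraicallyAnchoredPencils) :
    Theses.PadicSemiregularLift.HodgeAbelianVarieties := by
  obtain ⟨C⟩ := hC
  exact hc_av_of_lefAtDeg_diagonal_two (𝒪 := twistedReflexiveClass C Adm) (hDoor C)
    (fun m hm => admissibleRepresentativesLefAtDeg_twisted_of_exceptionalRegimeAt_prime C hAdm' (hDiag C m hm))
    (oneParameterAbelianSchemeQuasiProjective_of_raynaud1970 hR) h₂₁ h₂₂

/-- **The same from `(6, 3)` on, granted `HCUpToDim 5`** (Markman 2025 Cor. 1.3, UNREFEREED), for `Adm ⊇ bfSingleAdmissible'`.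
[cite: Andre1996Motifs, §6.3 Lemmes 6.3.1–6.3.3] [cite: Markman2025SurveySecant, Cor. 1.3]
[cite: BrosnanFangNiePearlstein2009, §6 Lemma 48] [cite: GortzWedhorn2023, Thm. 27.291] -/
theorem hc_av_of_hcUpToDim_five_of_exceptionalRegimeAt_twisted_diagonal_three_prime (hC : ChernCharacterOnBetti)
    {Adm : PerfectAdmissibility} (hAdm' : ∀ n X₀ I E, bfSingleAdmissible' n X₀ I E → Adm n X₀ I E) (h₅ : HCUpToDim 5)
    (hDiag : ∀ (C : ChernCharacterBetti) (m : ℕ), 3 ≤ m → LefAtExceptionalRegimeAt (twistedReflexiveClass C Adm) (2 * m) m)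
    (hDoor : ∀ C : ChernCharacterBetti, TwistedPerfectDoorVHC C Adm)
    (hR : raynaud1970_abelianScheme_section_projective) (h₂₁ : andre1996_cmAnchoredPencil)
    (h₂₂ : andre1996_cmHodgeClasses_algebraicallyAnchoredPencils) :
    Theses.PadicSemiregularLift.HodgeAbelianVarieties := by
  obtain ⟨C⟩ := hC
  exact hc_av_of_hcUpToDim_five_of_lefAtDeg_diagonal_three (𝒪 := twistedReflexiveClass C Adm) (hDoor C) h₅
    (fun m hm => admissibleRepresentativesLefAtDeg_twisted_of_exceptionalRegimeAt_prime C hAdm' (hDiag C m hm))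
    (oneParameterAbelianSchemeQuasiProjective_of_raynaud1970 hR) h₂₁ h₂₂

/-- **`HC_AV` in the `closes`-shape at the road's PRIMED twisted door `AdmTw' := gluableSigmaAdmissible ∨ bfSingleAdmissible'`**:
the diagonal crux slice READ AT `AdmTw'`, the restated binder `TwistedPerfectDoorVHC C AdmTw'`, K-C, Raynaud, André #21/#22 —
the glue LEAD 156 item (4) asks for («19275 restated + 19787 read at `AdmTw'`»). [cite: Andre1996Motifs, §6.3 Lemmes 6.3.1–6.3.3]
[cite: BrosnanFangNiePearlstein2009, §6 Lemma 48] [cite: Pridham2024Semiregularity, Rem. 2.26 with Cor. 2.25] -/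
theorem hc_av_of_exceptionalRegimeAt_admTw'_diagonal_two (hC : ChernCharacterOnBetti)
    (hDiag : ∀ (C : ChernCharacterBetti) (m : ℕ), 2 ≤ m →
      LefAtExceptionalRegimeAt (twistedReflexiveClass C
        (fun n X₀ I E => Summit.Ventures.HSemireg.gluableSigmaAdmissible n X₀ I E ∨ bfSingleAdmissible' n X₀ I E)) (2 * m) m)
    (hDoor : ∀ C : ChernCharacterBetti, TwistedPerfectDoorVHC C
      (fun n X₀ I E => Summit.Ventures.HSemireg.gluableSigmaAdmissible n X₀ I E ∨ bfSingleAdmissible' n X₀ I E))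
    (hR : raynaud1970_abelianScheme_section_projective) (h₂₁ : andre1996_cmAnchoredPencil)
    (h₂₂ : andre1996_cmHodgeClasses_algebraicallyAnchoredPencils) :
    Theses.PadicSemiregularLift.HodgeAbelianVarieties :=
  hc_av_of_exceptionalRegimeAt_twisted_diagonal_two_prime hC (fun _ _ _ _ h => Or.inr h) hDiag hDoor hR h₂₁ h₂₂

/-- **Mixed form: crux slice at `AdmTw'`, binder of record `TwistedPerfectDoorVHC C AdmTw` UNRESTATED** (the door of record
implies the primed door, `TwistedPerfectDoorVHC.or_bfSingle'_of_or_bfSingle`) — so reading 19787 at `AdmTw'` alone already closes with the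
binder as it stands. [cite: Andre1996Motifs, §6.3 Lemmes 6.3.1–6.3.3] [cite: BuchweitzFlenner2003, §5 Thm. 5.1 (binder shape)] -/
theorem hc_av_of_exceptionalRegimeAt_admTw'_diagonal_two_of_admTw_door (hC : ChernCharacterOnBetti)
    (hDiag : ∀ (C : ChernCharacterBetti) (m : ℕ), 2 ≤ m →
      LefAtExceptionalRegimeAt (twistedReflexiveClass C
        (fun n X₀ I E => Summit.Ventures.HSemireg.gluableSigmaAdmissible n X₀ I E ∨ bfSingleAdmissible' n X₀ I E)) (2 * m) m)
    (hDoor : ∀ C : ChernCharacterBetti, TwistedPerfectDoorVHC C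
      (fun n X₀ I E => Summit.Ventures.HSemireg.gluableSigmaAdmissible n X₀ I E ∨ bfSingleAdmissible n X₀ I E))
    (hR : raynaud1970_abelianScheme_section_projective) (h₂₁ : andre1996_cmAnchoredPencil)
    (h₂₂ : andre1996_cmHodgeClasses_algebraicallyAnchoredPencils) :
    Theses.PadicSemiregularLift.HodgeAbelianVarieties :=
  hc_av_of_exceptionalRegimeAt_admTw'_diagonal_two hC hDiag (fun C => (hDoor C).or_bfSingle'_of_or_bfSingle)
    hR h₂₁ h₂₂

end Summit.HodgeConjecture.HodgeConjecture.Ring2.SemiregularRepresentatives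

end
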